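import Mathlib
import Summits.ValiantsHypothesis.ValiantsHypothesis.Theorems.NewtonUnitEquationsDissociatedUniformTotalsLaw
import Summits.ValiantsHypothesis.ValiantsHypothesis.Theorems.NewtonUnitEquationsDissociatedUniformTotalsLawSmallThird
import Literature.Computability.AlgebraicComplexity.NewtonPolygonTauProductBounds
import HarnessLib

/-!
# Crux `NewtonUnitEquations.DissociatedUniform` (stmt-ValiantsHypothesis-5905): totals law — the small-third-curve regime in general position

Companion of `…TotalsLawSmallThird` (`T(a, b, μ • c) ≤ |G| · #∂S` for `0 ≤ μ ≤ μ₁`, `#∂S` = number of non-interior points of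
the pair sumset `S = A + B`).  In GENERAL POSITION — no line contains three sumset points, and `conv S` has nonempty interior —
every non-interior sumset point is a hull VERTEX (`mem_extremePoints_of_not_mem_interior`: supporting line at a boundary point by
geometric Hahn–Banach against the interior, the face on that line is the hull of at most two sumset points, and `p` is one of
them), so `#∂S ≤ vert(S)` (`bdryCount_le_ncard_extremePoints`) and the regime reads
`T(a, b, μ • c) ≤ |G| · vert(A + B) ≤ |G| · (vert A + vert B) ≤ 2|G|²` (`totalVert_smul_le_card_mul_vert`,
`totalVert_smul_le_two_mul_sq`) — the value `2q²` of memo `Cruxes/DissociatedUniform/NOTES-d1g3.md` §2 L5 at this end, and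
fibre-sum dominance with slack `0` there (`|G| · vert A ≤ V_R`-type comparisons are not made here).
No defs, no named facts; the law itself stays OPEN; nothing here bears on `VP ≠ VNP`.
[folklore]
-/

set_option linter.dupNamespace false -- `ValiantsHypothesis.ValiantsHypothesis` (summit = problem) in every name

open scoped BigOperators Pointwise
open Matrix

namespace Summit.ValiantsHypothesis.ValiantsHypothesis.Theorems.NewtonUnitEquationsDissociatedUniform

namespace TotalsLaw

/-! ### A boundary point of a planar point set in general position is a hull vertex -/

/-- **Endpoints.**  If `x₁, x₂` lie in the segment `[p, p']` and `p` is a proper convex combination of `x₁, x₂`, then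
`x₁ = x₂ = p`. [folklore] -/
theorem eq_of_mem_segment_of_combo {p p' x₁ x₂ : Fin 2 → ℝ} (h₁ : x₁ ∈ segment ℝ p p') (h₂ : x₂ ∈ segment ℝ p p')
    {θ₁ θ₂ : ℝ} (hθ₁ : 0 < θ₁) (hθ₂ : 0 < θ₂) (hθ : θ₁ + θ₂ = 1) (hcombo : θ₁ • x₁ + θ₂ • x₂ = p) :
    x₁ = p ∧ x₂ = p := by
  obtain ⟨a₁, b₁, ha₁, hb₁, hab₁, rfl⟩ := h₁
  obtain ⟨a₂, b₂, ha₂, hb₂, hab₂, rfl⟩ := h₂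
  by_cases hpp : p' = p
  · subst hpp
    constructor
    · rw [← add_smul, hab₁, one_smul]
    · rw [← add_smul, hab₂, one_smul]
  · -- a coordinate where `p' ≠ p`
    obtain ⟨i, hi⟩ := Function.ne_iff.1 hpp
    have hci := congr_fun hcombo i
    simp only [Pi.add_apply, Pi.smul_apply, smul_eq_mul] at hci
    have hkey : (θ₁ * b₁ + θ₂ * b₂) * (p' i - p i) = 0 := by
      have ha₁' : a₁ = 1 - b₁ := by linarith
      have ha₂' : a₂ = 1 - b₂ := by linarith
      rw [ha₁', ha₂'] at hci
      have hθ' : θ₂ = 1 - θ₁ := by linarith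
      rw [hθ'] at hci ⊢
      linear_combination hci
    have hsum : θ₁ * b₁ + θ₂ * b₂ = 0 := by
      rcases mul_eq_zero.1 hkey with h | h
      · exact h
      · exact absurd (sub_eq_zero.1 h) hi
    have hb₁0 : b₁ = 0 := by nlinarith [mul_nonneg hθ₁.le hb₁, mul_nonneg hθ₂.le hb₂]
    have hb₂0 : b₂ = 0 := by nlinarith [mul_nonneg hθ₁.le hb₁, mul_nonneg hθ₂.le hb₂]
    have ha₁1 : a₁ = 1 := by linarith
    have ha₂1 : a₂ = 1 := by linarith
    subst hb₁0 hb₂0 ha₁1 ha₂1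
    simp

/-- **Boundary points in general position are vertices.**  Let `S ⊂ ℝ²` be finite with no line containing three of its points and
with `conv S` of nonempty interior.  Then every point of `S` that is not an interior point of `conv S` is a vertex of `conv S`.
[folklore] -/
theorem mem_extremePoints_of_not_mem_interior {S : Finset (Fin 2 → ℝ)}
    (hS3 : ∀ w : Fin 2 → ℝ, w ≠ 0 → ∀ m : ℝ, (S.filter fun u => w ⬝ᵥ u = m).card ≤ 2)
    (hne : (interior (convexHull ℝ (S : Set (Fin 2 → ℝ)))).Nonempty)
    {p : Fin 2 → ℝ} (hp : p ∈ S) (hint : p ∉ interior (convexHull ℝ (S : Set (Fin 2 → ℝ)))) :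
    p ∈ (convexHull ℝ (S : Set (Fin 2 → ℝ))).extremePoints ℝ := by
  classical
  set K := convexHull ℝ (S : Set (Fin 2 → ℝ)) with hK
  have hKc : Convex ℝ K := convex_convexHull ℝ _
  -- a supporting functional at `p` (Hahn–Banach against the open convex interior)
  obtain ⟨f, hf⟩ := geometric_hahn_banach_open_point hKc.interior isOpen_interior hint
  set w : Fin 2 → ℝ := fun i => f (Pi.single i 1) with hw
  have hfw : ∀ y : Fin 2 → ℝ, f y = w ⬝ᵥ y := by
    intro y
    have hy : y = y 0 • (Pi.single 0 1 : Fin 2 → ℝ) + y 1 • (Pi.single 1 1 : Fin 2 → ℝ) := by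
      ext i; fin_cases i <;> simp
    conv_lhs => rw [hy]
    simp only [map_add, map_smul, smul_eq_mul, dotProduct, Fin.sum_univ_two, hw]
    ring
  have hle : ∀ y ∈ K, w ⬝ᵥ y ≤ w ⬝ᵥ p := by
    intro y hy
    have hcl : y ∈ closure (interior K) := by
      rw [hKc.closure_interior_eq_closure_of_nonempty_interior hne]; exact subset_closure hy
    have hclosed : IsClosed {a : Fin 2 → ℝ | f a ≤ f p} := isClosed_le f.continuous continuous_const
    have hsub : interior K ⊆ {a : Fin 2 → ℝ | f a ≤ f p} := fun a ha => (hf a ha).le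
    have h := (hclosed.closure_subset_iff.2 hsub) hcl
    rw [Set.mem_setOf_eq, hfw, hfw] at h
    exact h
  obtain ⟨a₀, ha₀⟩ := hne
  have hw0 : w ≠ 0 := by
    intro h0
    have := hf a₀ ha₀
    rw [hfw, hfw, h0, zero_dotProduct, zero_dotProduct] at this
    exact lt_irrefl _ this
  -- the face of `K` on the supporting line is the hull of `S₀ = S ∩ line`, at most two points
  set S₀ := S.filter fun u => w ⬝ᵥ u = w ⬝ᵥ p with hS₀
  set S₁ := S.filter fun u => ¬ w ⬝ᵥ u = w ⬝ᵥ p with hS₁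
  have hpS₀ : p ∈ S₀ := Finset.mem_filter.2 ⟨hp, rfl⟩
  have hcard : S₀.card ≤ 2 := hS3 w hw0 _
  have hS₀lev : ∀ u ∈ convexHull ℝ (S₀ : Set (Fin 2 → ℝ)), w ⬝ᵥ u = w ⬝ᵥ p := by
    intro u hu
    have h1 := convexHull_subset_halfPlane (S := (S₀ : Set (Fin 2 → ℝ))) (w := w) (m := w ⬝ᵥ p)
      (fun v hv => (Finset.mem_filter.1 (Finset.mem_coe.1 hv)).2.le) u hu
    have h2 := convexHull_subset_halfPlane (S := (S₀ : Set (Fin 2 → ℝ))) (w := -w) (m := -(w ⬝ᵥ p))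
      (fun v hv => by rw [neg_dotProduct, (Finset.mem_filter.1 (Finset.mem_coe.1 hv)).2]) u hu
    rw [neg_dotProduct] at h2
    linarith
  have hface : ∀ y ∈ K, w ⬝ᵥ y = w ⬝ᵥ p → y ∈ convexHull ℝ (S₀ : Set (Fin 2 → ℝ)) := by
    intro y hy hyp
    have hSU : (S : Set (Fin 2 → ℝ)) = (S₀ : Set (Fin 2 → ℝ)) ∪ (S₁ : Set (Fin 2 → ℝ)) := by
      rw [← Finset.coe_union, hS₀, hS₁, Finset.filter_union_filter_not_eq]
    by_cases hS₁e : S₁ = ∅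
    · have : (S : Set (Fin 2 → ℝ)) = (S₀ : Set (Fin 2 → ℝ)) := by rw [hSU, hS₁e, Finset.coe_empty, Set.union_empty]
      rw [hK, this] at hy
      exact hy
    · have hS₁ne : (S₁ : Set (Fin 2 → ℝ)).Nonempty := Finset.coe_nonempty.2 (Finset.nonempty_iff_ne_empty.2 hS₁e)
      have hS₀ne : (S₀ : Set (Fin 2 → ℝ)).Nonempty := ⟨p, Finset.mem_coe.2 hpS₀⟩
      rw [hK, hSU, convexHull_union hS₀ne hS₁ne, mem_convexJoin] at hy
      obtain ⟨u, hu, v, hv, a, b, ha, hb, hab, rfl⟩ := hy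
      -- `v` is strictly below the line
      obtain ⟨v₁, hv₁, hv₁max⟩ := S₁.exists_max_image (fun u => w ⬝ᵥ u) (Finset.nonempty_iff_ne_empty.2 hS₁e)
      have hv₁lt : w ⬝ᵥ v₁ < w ⬝ᵥ p := by
        obtain ⟨hv₁S, hv₁ne⟩ := Finset.mem_filter.1 hv₁
        exact lt_of_le_of_ne (hle v₁ (subset_convexHull ℝ _ (Finset.mem_coe.2 hv₁S))) hv₁ne
      have hvle : w ⬝ᵥ v ≤ w ⬝ᵥ v₁ := convexHull_subset_halfPlane (S := (S₁ : Set (Fin 2 → ℝ)))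
        (fun u hu => hv₁max u (Finset.mem_coe.1 hu)) v hv
      have hu' := hS₀lev u hu
      rw [dotProduct_add, dotProduct_smul, dotProduct_smul, smul_eq_mul, smul_eq_mul, hu'] at hyp
      have hb0 : b = 0 := by
        by_contra hb0
        have h1 : b * (w ⬝ᵥ p - w ⬝ᵥ v) = 0 := by linear_combination (w ⬝ᵥ p) * hab - hyp
        rcases mul_eq_zero.1 h1 with h | h
        · exact hb0 h
        · linarith
      subst hb0
      have ha1 : a = 1 := by linarith
      subst ha1
      simpa using hu
  -- conclude with the endpoint lemma
  rw [mem_extremePoints]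
  refine ⟨subset_convexHull ℝ _ (Finset.mem_coe.2 hp), fun x₁ hx₁ x₂ hx₂ hseg => ?_⟩
  obtain ⟨θ₁, θ₂, hθ₁, hθ₂, hθ, hpeq⟩ := hseg
  have e1 := hle x₁ hx₁
  have e2 := hle x₂ hx₂
  have hsum : w ⬝ᵥ p = θ₁ * (w ⬝ᵥ x₁) + θ₂ * (w ⬝ᵥ x₂) := by
    rw [← hpeq, dotProduct_add, dotProduct_smul, dotProduct_smul, smul_eq_mul, smul_eq_mul]
  have h0 : θ₁ * (w ⬝ᵥ p - w ⬝ᵥ x₁) + θ₂ * (w ⬝ᵥ p - w ⬝ᵥ x₂) = 0 := by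
    linear_combination (w ⬝ᵥ p) * hθ + hsum
  have t1 : 0 ≤ θ₁ * (w ⬝ᵥ p - w ⬝ᵥ x₁) := mul_nonneg hθ₁.le (by linarith)
  have t2 : 0 ≤ θ₂ * (w ⬝ᵥ p - w ⬝ᵥ x₂) := mul_nonneg hθ₂.le (by linarith)
  have hx₁eq : w ⬝ᵥ x₁ = w ⬝ᵥ p := by
    have : θ₁ * (w ⬝ᵥ p - w ⬝ᵥ x₁) = 0 := by linarith
    rcases mul_eq_zero.1 this with h | h
    · exact absurd h hθ₁.ne'
    · linarith
  have hx₂eq : w ⬝ᵥ x₂ = w ⬝ᵥ p := by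
    have : θ₂ * (w ⬝ᵥ p - w ⬝ᵥ x₂) = 0 := by linarith
    rcases mul_eq_zero.1 this with h | h
    · exact absurd h hθ₂.ne'
    · linarith
  have hx₁' := hface x₁ hx₁ hx₁eq
  have hx₂' := hface x₂ hx₂ hx₂eq
  -- `S₀ ⊆ {p, p'}`: its hull is a segment from `p`
  obtain ⟨p', hsub⟩ : ∃ p', (S₀ : Set (Fin 2 → ℝ)) ⊆ {p, p'} := by
    by_cases h1 : S₀.card ≤ 1
    · exact ⟨p, fun u hu => by
        rw [Finset.card_le_one] at h1
        simp [h1 u (Finset.mem_coe.1 hu) p hpS₀]⟩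
    · have h2 : S₀.card = 2 := by omega
      obtain ⟨u, v, huv, hS₀eq⟩ := Finset.card_eq_two.1 h2
      have hpuv : p = u ∨ p = v := by simpa [hS₀eq] using hpS₀
      rcases hpuv with rfl | rfl
      · exact ⟨v, by rw [hS₀eq]; simp⟩
      · exact ⟨u, by rw [hS₀eq, Finset.coe_pair, Set.pair_comm]⟩
  have hseg : convexHull ℝ (S₀ : Set (Fin 2 → ℝ)) ⊆ segment ℝ p p' := by
    rw [← convexHull_pair]
    exact convexHull_mono hsub
  exact eq_of_mem_segment_of_combo (hseg hx₁') (hseg hx₂') hθ₁ hθ₂ hθ hpeq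

/-! ### The small-third-curve regime in general position -/

variable {G : Type*} [AddCommGroup G] [Fintype G]

omit [AddCommGroup G] in
/-- **`#∂S ≤ vert(S)` in general position.**  If no line contains three points of the pair sumset and its hull has nonempty
interior, the non-interior sumset points are hull vertices. [folklore] -/
theorem bdryCount_le_ncard_extremePoints (a b : G → (Fin 2 → ℝ))
    (hS3 : ∀ w : Fin 2 → ℝ, w ≠ 0 → ∀ m : ℝ, {p | p ∈ pairPts a b ∧ w ⬝ᵥ p = m}.ncard ≤ 2)
    (hne : (interior (convexHull ℝ (pairPts a b))).Nonempty) :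
    bdryCount a b ≤ ((convexHull ℝ (pairPts a b)).extremePoints ℝ).ncard := by
  classical
  set S : Finset (Fin 2 → ℝ) := Finset.univ.image fun p : G × G => a p.1 + b p.2 with hSdef
  have hS : (S : Set (Fin 2 → ℝ)) = pairPts a b := by
    rw [hSdef, Finset.coe_image, Finset.coe_univ, Set.image_univ]; rfl
  have hS3' : ∀ w : Fin 2 → ℝ, w ≠ 0 → ∀ m : ℝ, (S.filter fun u => w ⬝ᵥ u = m).card ≤ 2 := by
    intro w hw m
    have h := hS3 w hw m
    have : {p | p ∈ pairPts a b ∧ w ⬝ᵥ p = m} = ((S.filter fun u => w ⬝ᵥ u = m : Finset (Fin 2 → ℝ)) :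
        Set (Fin 2 → ℝ)) := by
      ext u; rw [Finset.coe_filter, ← hS]; rfl
    rwa [this, Set.ncard_coe_finset] at h
  unfold bdryCount
  refine Set.ncard_le_ncard (fun p hp => ?_) ((Set.finite_range _).subset extremePoints_convexHull_subset)
  obtain ⟨hpS, hpint⟩ := hp
  rw [← hS] at hpS hpint ⊢
  rw [← hS] at hne
  exact mem_extremePoints_of_not_mem_interior hS3' hne (Finset.mem_coe.1 hpS) hpint

/-- **The small-third-curve regime in general position: `T(a, b, μ • c) ≤ |G| · vert(A + B)`** for `0 ≤ μ ≤ μ₁` (pair sums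
distinct, no three sumset points on a line, `conv(A + B)` with nonempty interior). [folklore] -/
theorem totalVert_smul_le_card_mul_vert (a b c : G → (Fin 2 → ℝ)) (hab : Function.Injective fun p : G × G => a p.1 + b p.2)
    (hS3 : ∀ w : Fin 2 → ℝ, w ≠ 0 → ∀ m : ℝ, {p | p ∈ pairPts a b ∧ w ⬝ᵥ p = m}.ncard ≤ 2)
    (hne : (interior (convexHull ℝ (pairPts a b))).Nonempty) :
    ∃ μ₁ : ℝ, 0 < μ₁ ∧ ∀ μ : ℝ, 0 ≤ μ → μ ≤ μ₁ →
      totalVert a b (μ • c) ≤ Fintype.card G * ((convexHull ℝ (pairPts a b)).extremePoints ℝ).ncard := by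
  obtain ⟨μ₁, hμ₁, h⟩ := totalVert_smul_le_card_mul_bdryCount a b c hab
  exact ⟨μ₁, hμ₁, fun μ h0 h1 => (h μ h0 h1).trans
    (Nat.mul_le_mul_left _ (bdryCount_le_ncard_extremePoints a b hS3 hne))⟩

/-- `vert(A + B) ≤ vert A + vert B ≤ 2|G|` for the pair sumset (the tree's planar Minkowski bound). [folklore] -/
theorem ncard_extremePoints_pairPts_le (a b : G → (Fin 2 → ℝ)) :
    ((convexHull ℝ (pairPts a b)).extremePoints ℝ).ncard ≤ 2 * Fintype.card G := by
  classical
  have hA : (Finset.univ.image a : Finset (Fin 2 → ℝ)).Nonempty := ⟨a 0, Finset.mem_image.2 ⟨0, Finset.mem_univ _, rfl⟩⟩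
  have hB : (Finset.univ.image b : Finset (Fin 2 → ℝ)).Nonempty := ⟨b 0, Finset.mem_image.2 ⟨0, Finset.mem_univ _, rfl⟩⟩
  have hS : pairPts a b = ((Finset.univ.image a + Finset.univ.image b : Finset (Fin 2 → ℝ)) : Set (Fin 2 → ℝ)) := by
    ext p
    simp only [pairPts, Set.mem_range, Prod.exists, Finset.coe_add, Finset.coe_image, Finset.coe_univ, Set.image_univ,
      Set.mem_add, Set.mem_range]
    constructor
    · rintro ⟨x, y, rfl⟩; exact ⟨a x, ⟨x, rfl⟩, b y, ⟨y, rfl⟩, rfl⟩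
    · rintro ⟨_, ⟨x, rfl⟩, _, ⟨y, rfl⟩, rfl⟩; exact ⟨x, y, rfl⟩
  rw [hS]
  refine (Literature.Computability.AlgebraicComplexity.KPTT.PlanarMinkowski.ncard_extremePoints_add_le hA hB).trans ?_
  have h1 := Literature.Computability.AlgebraicComplexity.KPTT.PlanarMinkowski.ncard_extremePoints_le_card
    (Finset.univ.image a : Finset (Fin 2 → ℝ))
  have h2 := Literature.Computability.AlgebraicComplexity.KPTT.PlanarMinkowski.ncard_extremePoints_le_card
    (Finset.univ.image b : Finset (Fin 2 → ℝ))
  have h3 : (Finset.univ.image a : Finset (Fin 2 → ℝ)).card ≤ Fintype.card G := Finset.card_image_le.trans (by simp)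
  have h4 : (Finset.univ.image b : Finset (Fin 2 → ℝ)).card ≤ Fintype.card G := Finset.card_image_le.trans (by simp)
  omega

/-- **`T(a, b, μ • c) ≤ 2|G|²` for `0 ≤ μ ≤ μ₁` in general position** — the memo's value at the small-third-curve end
(NOTES-d1g3 §2 L5: "every class is the pair-sumset hull, `≤ 2q` each"). [folklore] -/
theorem totalVert_smul_le_two_mul_sq (a b c : G → (Fin 2 → ℝ)) (hab : Function.Injective fun p : G × G => a p.1 + b p.2)
    (hS3 : ∀ w : Fin 2 → ℝ, w ≠ 0 → ∀ m : ℝ, {p | p ∈ pairPts a b ∧ w ⬝ᵥ p = m}.ncard ≤ 2)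
    (hne : (interior (convexHull ℝ (pairPts a b))).Nonempty) :
    ∃ μ₁ : ℝ, 0 < μ₁ ∧ ∀ μ : ℝ, 0 ≤ μ → μ ≤ μ₁ → totalVert a b (μ • c) ≤ 2 * Fintype.card G ^ 2 := by
  obtain ⟨μ₁, hμ₁, h⟩ := totalVert_smul_le_card_mul_vert a b c hab hS3 hne
  refine ⟨μ₁, hμ₁, fun μ h0 h1 => (h μ h0 h1).trans ?_⟩
  have := Nat.mul_le_mul_left (Fintype.card G) (ncard_extremePoints_pairPts_le a b)
  calc Fintype.card G * ((convexHull ℝ (pairPts a b)).extremePoints ℝ).ncard ≤ Fintype.card G * (2 * Fintype.card G) := this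
    _ = 2 * Fintype.card G ^ 2 := by ring

end TotalsLaw

end Summit.ValiantsHypothesis.ValiantsHypothesis.Theorems.NewtonUnitEquationsDissociatedUniform
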